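import Literature.NumberTheory.Sieve.FordMaynardFragmentationBridge
import Literature.NumberTheory.Sieve.FordMaynardFragmentationSymm
import HarnessLib

/-!
# Ford–Maynard's fragmentation operator: symmetry and linearity

Properties of the (fsl)-extension operator `fragOp γ η g` of
`Literature/NumberTheory/Sieve/FordMaynardFragmentation.lean` (K. Ford, J. Maynard, *On the theory
of prime producing sieves*, arXiv:2407.14368, §6.1 (6.3)) needed to use functions DEFINED by (fsl)
as members of `𝔉_η` (proofs of Theorems 6.3 (a) and 9.1). Everything here is PROVED.

* `fragOp_comp_perm` — for `g ∈ 𝒮`, `fragOp γ η g` is symmetric in each dimension (permute the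
  block sizes, the rows of the flat coordinates, and the blocks of the fragmentation);
* `fragOp_sub` — `fragOp` is linear in `g` (for bounded measurable data);
* `abs_fragOp_le_of_forall` — a crude pointwise bound from a bound on the flat integrals.

## References

* K. Ford, J. Maynard, *On the theory of prime producing sieves*, arXiv:2407.14368v1 (2024), §6.1
  (6.3), §6.2 and §9. [FordMaynard2024PrimeSieves]
-/

noncomputable section

open MeasureTheory Finset

namespace Literature.NumberTheory.Sieve.FordMaynard

/-! ### Re-indexing sums over `piFinset` by a permutation of the index -/

/-- `∑_{kv ∈ S^m} F(kv ∘ σ) = ∑_{kv ∈ S^m} F(kv)` for a permutation `σ` of `Fin m`. [folklore] -/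
theorem sum_piFinset_comp_equiv {α : Type*} {m : ℕ} (S : Finset α) (σ : Equiv.Perm (Fin m))
    (F : (Fin m → α) → ℝ) :
    ∑ kv ∈ Fintype.piFinset (fun _ : Fin m => S), F (kv ∘ σ) =
      ∑ kv ∈ Fintype.piFinset (fun _ : Fin m => S), F kv := by
  refine Finset.sum_nbij' (fun kv => kv ∘ σ) (fun kv => kv ∘ σ.symm) ?_ ?_ ?_ ?_ ?_
  · intro kv h; rw [Fintype.mem_piFinset] at h ⊢; exact fun i => h _
  · intro kv h; rw [Fintype.mem_piFinset] at h ⊢; exact fun i => h _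
  · intro kv _; funext i; simp
  · intro kv _; funext i; simp
  · intro kv _; rfl

/-! ### Symmetry of `fragOp` -/

/-- Rows of the flat coordinates after permuting the row index. [folklore] -/
theorem rowOf_comp_prodCongr {m N : ℕ} (σ : Equiv.Perm (Fin m)) (V : Fin m × Fin N → ℝ) (j : Fin m) :
    rowOf (V ∘ (Equiv.prodCongr σ (Equiv.refl (Fin N)))) j = rowOf V (σ j) := by
  funext i
  unfold rowOf
  split_ifs <;> rfl

/-- The integrand of (6.3) is invariant under a simultaneous permutation of the block sizes, the
components of `ξ` and the rows of the flat coordinates (for `g ∈ 𝒮`). [cite: FordMaynard2024PrimeSieves, §6.1 (6.3)] -/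
theorem fragIntegrand_comp_perm {γ η : ℝ} {N : ℕ} {g : VecFn} (hg : g.IsSymmetric) {m : ℕ}
    (σ : Equiv.Perm (Fin m)) (kv : Fin m → ℕ) (ξ : Fin m → ℝ) (V : Fin m × Fin N → ℝ) :
    fragIntegrand γ η N g (kv ∘ σ) (ξ ∘ σ) (V ∘ (Equiv.prodCongr σ (Equiv.refl (Fin N)))) =
      fragIntegrand γ η N g kv ξ V := by
  set ρ := Equiv.prodCongr σ (Equiv.refl (Fin N)) with hρ
  unfold fragIntegrand
  by_cases hc : ∀ j, BlockCond η N (kv j) (ξ j) (rowOf V j)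
  · have hc' : ∀ j, BlockCond η N ((kv ∘ σ) j) ((ξ ∘ σ) j) (rowOf (V ∘ ρ) j) := fun j => by
      rw [hρ, rowOf_comp_prodCongr]; exact hc (σ j)
    rw [if_pos hc', if_pos hc]
    have hrow : ∀ j, rowOf (V ∘ ρ) j = rowOf V (σ j) := fun j => by rw [hρ, rowOf_comp_prodCongr]
    congr 1
    · simp only [Function.comp_apply, hrow]
      exact Equiv.prod_comp σ (fun j => blockWeight γ (kv j) (blockVec (kv j) (ξ j) (rowOf V j)))
    · -- the two fragmentations differ by a re-indexing of the blocks
      set W : Fin (∑ j, kv j) → ℝ := concatBlocks kv fun j => blockVec (kv j) (ξ j) (rowOf V j) with hW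
      set E : Fin (∑ j, (kv ∘ σ) j) ≃ Fin (∑ j, kv j) :=
        (finSigmaFinEquiv (n := kv ∘ σ)).symm.trans
          ((Equiv.sigmaCongrLeft (β := fun j' => Fin (kv j')) σ).trans (finSigmaFinEquiv (n := kv)))
        with hE
      have hWE : (concatBlocks (kv ∘ σ) fun j => blockVec ((kv ∘ σ) j) ((ξ ∘ σ) j) (rowOf (V ∘ ρ) j)) =
          W ∘ E := by
        funext t
        obtain ⟨p, rfl⟩ := (finSigmaFinEquiv (n := kv ∘ σ)).surjective t
        rw [concatBlocks_apply_equiv]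
        have hEp : E (finSigmaFinEquiv p) = finSigmaFinEquiv (n := kv) ⟨σ p.1, p.2⟩ := by
          show finSigmaFinEquiv (n := kv) ((Equiv.sigmaCongrLeft (β := fun j' => Fin (kv j')) σ)
            ((finSigmaFinEquiv (n := kv ∘ σ)).symm (finSigmaFinEquiv (n := kv ∘ σ) p))) = _
          rw [Equiv.symm_apply_apply]
          rfl
        show blockVec (kv (σ p.1)) (ξ (σ p.1)) (rowOf (V ∘ ρ) p.1) p.2 = W (E (finSigmaFinEquiv p))
        rw [hEp, hW, concatBlocks_apply_equiv, hrow]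
      rw [hWE]
      exact hg.apply_comp_equiv E W
  · have hc' : ¬ ∀ j, BlockCond η N ((kv ∘ σ) j) ((ξ ∘ σ) j) (rowOf (V ∘ ρ) j) := by
      intro h
      refine hc fun j => ?_
      have := h (σ.symm j)
      rw [hρ, rowOf_comp_prodCongr] at this
      simpa using this
    rw [if_neg hc', if_neg hc]

/-- **`fragOp γ η g` is symmetric** in each dimension for `g ∈ 𝒮`. [cite: FordMaynard2024PrimeSieves, §6.1 (6.3) and Definition 6.1] -/
theorem fragOp_comp_perm {γ η : ℝ} {g : VecFn} (hg : g.IsSymmetric) {m : ℕ} (σ : Equiv.Perm (Fin m))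
    (ξ : Fin m → ℝ) : fragOp γ η g m (ξ ∘ σ) = fragOp γ η g m ξ := by
  classical
  unfold fragOp
  congr 1
  · exact Equiv.prod_comp σ ξ
  · set N := maxBlock η with hN
    rw [← sum_piFinset_comp_equiv (Finset.Icc 1 N) σ]
    refine Finset.sum_congr rfl fun kv _ => ?_
    -- change variables in the flat integral: `U = V ∘ (σ × id)`
    set ρ : (Fin m × Fin N) ≃ (Fin m × Fin N) := Equiv.prodCongr σ (Equiv.refl (Fin N)) with hρ
    set T := MeasurableEquiv.piCongrLeft (fun _ : Fin m × Fin N => ℝ) ρ with hT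
    have hmp : MeasurePreserving T.symm := (volume_measurePreserving_piCongrLeft (fun _ => ℝ) ρ).symm
    have hTs : ∀ V : Fin m × Fin N → ℝ, T.symm V = V ∘ ρ := by
      intro V; funext q
      show (Equiv.piCongrLeft (fun _ : Fin m × Fin N => ℝ) ρ).symm V q = V (ρ q)
      rw [Equiv.piCongrLeft_symm_apply]
    rw [← hmp.integral_comp' (f := T.symm)]
    refine integral_congr_ae (Filter.Eventually.of_forall fun V => ?_)
    show fragIntegrand γ η N g (kv ∘ σ) (ξ ∘ σ) (T.symm V) = fragIntegrand γ η N g kv ξ V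
    rw [hTs V]
    exact fragIntegrand_comp_perm hg σ kv ξ V

/-- **Symmetry of `fragOp` as a function on vectors.** [cite: FordMaynard2024PrimeSieves, Definition 6.1] -/
theorem isSymmetric_fragOp {γ η : ℝ} {g : VecFn} (hg : g.IsSymmetric) : (fragOp γ η g).IsSymmetric :=
  fun _ σ ξ => fragOp_comp_perm hg σ ξ

/-! ### Linearity and a pointwise bound -/

/-- The integrand of (6.3) is additive in `g`. [folklore] -/
theorem fragIntegrand_sub {γ η : ℝ} {N : ℕ} (g g' : VecFn) {m : ℕ} (kv : Fin m → ℕ) (ξ : Fin m → ℝ)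
    (U : Fin m × Fin N → ℝ) :
    fragIntegrand γ η N (fun n w => g n w - g' n w) kv ξ U =
      fragIntegrand γ η N g kv ξ U - fragIntegrand γ η N g' kv ξ U := by
  unfold fragIntegrand
  split_ifs <;> ring

open scoped Classical in
/-- The integrand of (6.3) as a flat integrand: `fragIntegrand = 𝟙[BlockCond] · H(concatBlocks)` with
`H(β) = (∏_j blockWeight(β_j)) · g(β)`, `β_j` the `j`-th block of `β`. [folklore] -/
theorem fragIntegrand_eq_flat {γ η : ℝ} {N : ℕ} (g : VecFn) {m : ℕ} (kv : Fin m → ℕ) (ξ : Fin m → ℝ)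
    (U : Fin m × Fin N → ℝ) :
    fragIntegrand γ η N g kv ξ U =
      if ∀ j, BlockCond η N (kv j) (ξ j) (rowOf U j) then
        (fun β : Fin (∑ j, kv j) → ℝ =>
          (∏ j, blockWeight γ (kv j) (fun i => β (finSigmaFinEquiv (n := kv) ⟨j, i⟩))) *
            g (∑ j, kv j) β)
          (concatBlocks kv fun j => blockVec (kv j) (ξ j) (rowOf U j))
      else 0 := by
  unfold fragIntegrand
  split_ifs with hc
  · simp only [concatBlocks_apply_equiv]
  · rfl

/-- Measurability of the flat integrand `H(β) = (∏_j blockWeight(β_j)) · g(β)`. [folklore] -/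
theorem measurable_flatH {γ : ℝ} {g : VecFn} (hgm : ∀ n, Measurable (g n)) {m : ℕ} (kv : Fin m → ℕ) :
    Measurable (fun β : Fin (∑ j, kv j) → ℝ =>
      (∏ j, blockWeight γ (kv j) (fun i => β (finSigmaFinEquiv (n := kv) ⟨j, i⟩))) * g (∑ j, kv j) β) := by
  refine Measurable.mul (Finset.measurable_prod _ fun j _ => ?_) (hgm _)
  exact (measurable_blockWeight γ (kv j)).comp (measurable_pi_lambda _ fun i => measurable_pi_apply _)

/-- A bound for the flat integrand on vectors with entries `≥ η`: `|H(β)| ≤ W_b^m · F`, where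
`W_b = N (2^N)^N / η^N` bounds the block weights (`1 ≤ k_j ≤ N`) and `F` bounds `g`. [folklore] -/
theorem abs_flatH_le {γ η : ℝ} (hη : 0 < η) (hη1 : η ≤ 1) {g : VecFn} {F : ℝ} (hF : ∀ n v, |g n v| ≤ F)
    {m N : ℕ} {kv : Fin m → ℕ} (hkv : ∀ j, 1 ≤ kv j ∧ kv j ≤ N) (β : Fin (∑ j, kv j) → ℝ)
    (hβ : ∀ t, η ≤ β t) :
    |(∏ j, blockWeight γ (kv j) (fun i => β (finSigmaFinEquiv (n := kv) ⟨j, i⟩))) * g (∑ j, kv j) β| ≤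
      (N * (2 ^ N) ^ N / η ^ N) ^ m * F := by
  have hF0 : 0 ≤ F := (abs_nonneg _).trans (hF 0 fun i => i.elim0)
  rw [abs_mul, Finset.abs_prod]
  refine mul_le_mul ?_ (hF _ _) (abs_nonneg _) (by positivity)
  calc ∏ j, |blockWeight γ (kv j) (fun i => β (finSigmaFinEquiv (n := kv) ⟨j, i⟩))|
      ≤ ∏ _j : Fin m, (N * (2 ^ N) ^ N / η ^ N : ℝ) := by
        refine Finset.prod_le_prod (fun j _ => abs_nonneg _) fun j _ => ?_
        refine (abs_blockWeight_le hη (kv j) _ fun i => hβ _).trans ?_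
        -- monotonicity in `k ≤ N`
        obtain ⟨hk1, hkN⟩ := hkv j
        have h2 : (1 : ℝ) ≤ 2 ^ kv j := one_le_pow₀ (by norm_num)
        have hnum : (kv j : ℝ) * (2 ^ kv j) ^ kv j ≤ N * (2 ^ N) ^ N := by
          have h1 : ((2 : ℝ) ^ kv j) ^ kv j ≤ (2 ^ N) ^ N :=
            (pow_le_pow_left₀ (by positivity) (pow_le_pow_right₀ (by norm_num) hkN) _).trans
              (pow_le_pow_right₀ (one_le_pow₀ (by norm_num)) hkN)
          exact mul_le_mul (by exact_mod_cast hkN) h1 (by positivity) (Nat.cast_nonneg _)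
        have hden : η ^ N ≤ η ^ kv j := pow_le_pow_of_le_one hη.le hη1 hkN
        exact div_le_div₀ (by positivity) hnum (pow_pos hη N) hden
    _ = (N * (2 ^ N) ^ N / η ^ N) ^ m := by
        rw [Finset.prod_const, Finset.card_univ, Fintype.card_fin]

/-- **`fragOp` is linear in `g`** (bounded measurable data, `0 < η ≤ 1`). [folklore] -/
theorem fragOp_sub {γ η : ℝ} (hη : 0 < η) (hη1 : η ≤ 1) {g g' : VecFn} (hgm : ∀ n, Measurable (g n))
    (hg'm : ∀ n, Measurable (g' n)) {F : ℝ} (hF : ∀ n v, |g n v| ≤ F) (hF' : ∀ n v, |g' n v| ≤ F)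
    (m : ℕ) (ξ : Fin m → ℝ) :
    fragOp γ η (fun n w => g n w - g' n w) m ξ = fragOp γ η g m ξ - fragOp γ η g' m ξ := by
  classical
  unfold fragOp
  rw [← mul_sub, ← Finset.sum_sub_distrib]
  congr 1
  refine Finset.sum_congr rfl fun kv hkv => ?_
  have hkv' : ∀ j, 1 ≤ kv j ∧ kv j ≤ maxBlock η := fun j => by
    have := Fintype.mem_piFinset.1 hkv j; simpa using this
  have hF0 : 0 ≤ F := (abs_nonneg _).trans (hF 0 fun i => i.elim0)
  have hint : ∀ g₀ : VecFn, (∀ n, Measurable (g₀ n)) → (∀ n v, |g₀ n v| ≤ F) →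
      Integrable fun U : Fin m × Fin (maxBlock η) → ℝ => fragIntegrand γ η (maxBlock η) g₀ kv ξ U := by
    intro g₀ hg₀m hg₀F
    have := integrable_flatIntegrand (η := η) (N := maxBlock η) kv ξ (measurable_flatH (γ := γ) hg₀m kv)
      (C := (maxBlock η * (2 ^ maxBlock η) ^ maxBlock η / η ^ maxBlock η) ^ m * F) (by positivity)
      (fun β hβ => abs_flatH_le hη hη1 hg₀F hkv' β hβ)
    exact this.congr (Filter.Eventually.of_forall fun U => (fragIntegrand_eq_flat g₀ kv ξ U).symm)
  rw [← integral_sub (hint g hgm hF) (hint g' hg'm hF')]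
  exact integral_congr_ae (Filter.Eventually.of_forall fun U => fragIntegrand_sub g g' kv ξ U)

end Literature.NumberTheory.Sieve.FordMaynard
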